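import Mathlib
import HarnessLib
import Summits.NavierStokesRegularity.NavierStokesRegularity.Theorems.UnthreadedDoorCellFluxDefs
import Summits.NavierStokesRegularity.NavierStokesRegularity.Theorems.UnthreadedDoorNetFluxAnalyticValueGluing
import Summits.NavierStokesRegularity.NavierStokesRegularity.Theorems.UnthreadedDoorNetFluxLevelLipschitzAnalytic
import Summits.NavierStokesRegularity.NavierStokesRegularity.Theorems.UnthreadedDoorNetFluxDenseFiniteZeroScalarLiouville

/-!
# Route `UnthreadedDoor`, crux `PoloidalLiouville` (stmt-NavierStokesRegularity-1222), WALL W1 — crux idea «cell-flux» / «indicatrix-bound»: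
# HEAD COHERENCE (`CellFlux.HeadCoherent`) OF EVERY PRECONNECTED REGULAR CLASS OF AN ANALYTIC SLICE, BY NAME

Support file (seat leafhand-ns-unthreadeddoor-3 g7, cell decomp-ns), `--supports stmt-NavierStokesRegularity-1222 --as helper`; theorems only,
no new definitions.

The cell-flux chain (Theorems-side vocabulary `…UnthreadedDoorCellFluxDefs`, p692073) runs on ADMISSIBLE CLUSTER RULES whose classes must be
HEAD-COHERENT: `HeadCoherent f g L K := ∃ G, LipschitzWith L G ∧ ∀ x ∈ closure K, g x = G (f x)` — ONE Lipschitz height function represents the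
head `g = P(t)` through the potential `f = T(t)` on the closed class.  Its docstring books this, for one cell of an analytic slice, as «the cell
version of K1⁺».  This file lands that cell version BY NAME, from the cell form of K1⁺ just appended to `…NetFluxAnalyticValueGluing`
(`NetFlux.slice_le_of_analytic_regular_on_closure`, p828908):

* `headCoherent_of_slice_le` — the slice inequality `|g x − g y| ≤ L |f x − f y|` on `closure K` ⇒ `HeadCoherent f g L K` (a value selector on
  `f '' closure K` is `L`-Lipschitz there; McShane extension `LipschitzOnWith.extend_real`);
* `HeadCoherent.mono` — coherence passes to subsets;
* ★ `headCoherent_of_analytic_regular_on` — on `S_r(x₀)` (`r > 0`), `f, μ` analytic and `g ∈ C¹` off `x₀`, `∇g − μ∇f ∥ (x − x₀)` and `|μ| ≤ L` on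
  the sphere: EVERY preconnected set `C ⊆ S_r` of regular points of `f|_{S_r}` is head-coherent, `HeadCoherent f g L C` (hence so is every `K` with
  `K ⊆ C`, e.g. a cell minus its isolated critical points, and the representation holds on `closure C` — sheet traces included);
* ★ `headCoherent_sphere_of_analytic_finiteCrit` — a sphere with finitely many critical points (one cell) is head-coherent as a whole (K1⁺, p679110);
* ★ `headCoherent_of_linked_analytic_on` — the same in the binders of Λ-1 `HeadClusterRuleTame` / `AdmissibleRule` at one instant: `v` analytic with
  `‖v‖ ≤ V` on the sphere, `μ = ⟪v, · − x₀⟫` (analytic: `NetFlux.analyticOnNhd_loopMomentum'`; `|μ| ≤ r V` there), head relation `(∇P − ⟪v, · − x₀⟫ ∇T) × (x − x₀) = 0` ⇒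
  `HeadCoherent T P (r * V) C` for every preconnected regular `C ⊆ S_r(x₀)`.

WHAT THIS IS NOT: the topological input «a cell minus its (finitely many) isolated critical points is preconnected» and the EVENT bookkeeping of
Λ-1 (births / deaths / reconnections of sheet traces, joint continuity of the cluster flux) are not touched; Λ-1, Λ-2, Σ-0bR₂, Σ-0e, C⁻,
`PoloidalLiouville` (1222), W1 and NS regularity stay OPEN; no summit statement is proved. [folklore]
-/

noncomputable section

set_option linter.dupNamespace false

open Set Function Filter Topology Metric
open scoped RealInnerProductSpace NNReal

namespace Summit.NavierStokesRegularity.NavierStokesRegularity.Theorems.PoloidalLiouville.CellFlux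

open Summit.NavierStokesRegularity.NavierStokesRegularity.Theorems.PoloidalLiouville.NetFlux (E3)
open Literature.Analysis Literature.Analysis.FluidPDE

/-! ### 1. Packaging: the slice inequality on a closed class is head coherence -/

/-- **Slice inequality on `closure K` ⇒ `HeadCoherent f g L K`.**  If `|g x − g y| ≤ L |f x − f y|` for all `x, y ∈ closure K`, then `g = G ∘ f`
on `closure K` for an `L`-Lipschitz `G : ℝ → ℝ` (`Real.toNNReal L` as in the definition): choose a preimage selector on `f '' closure K`, observe
that `c ↦ g (sel c)` is `L`-Lipschitz there and agrees with `g` along the fibres, and extend it to `ℝ` by McShane. [folklore] -/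
theorem headCoherent_of_slice_le {f g : E3 → ℝ} {L : ℝ} {K : Set E3}
    (h : ∀ x ∈ closure K, ∀ y ∈ closure K, |g x - g y| ≤ L * |f x - f y|) : HeadCoherent f g L K := by
  classical
  have hsel : ∀ c ∈ f '' closure K, ∃ x ∈ closure K, f x = c := fun c hc => by
    obtain ⟨x, hx, rfl⟩ := hc
    exact ⟨x, hx, rfl⟩
  choose! sel hselK hself using hsel
  set G₀ : ℝ → ℝ := fun c => g (sel c) with hG₀
  have hLip : LipschitzOnWith (Real.toNNReal L) G₀ (f '' closure K) := by
    refine LipschitzOnWith.of_dist_le_mul fun c hc c' hc' => ?_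
    have h1 := h (sel c) (hselK c hc) (sel c') (hselK c' hc')
    rw [hself c hc, hself c' hc'] at h1
    rw [Real.dist_eq, Real.dist_eq, Real.coe_toNNReal']
    exact h1.trans (mul_le_mul_of_nonneg_right (le_max_left _ _) (abs_nonneg _))
  obtain ⟨G, hG, hEq⟩ := hLip.extend_real
  refine ⟨G, hG, fun x hx => ?_⟩
  have hc : f x ∈ f '' closure K := mem_image_of_mem f hx
  have h0 : g x = G₀ (f x) := by
    have h1 := h x hx (sel (f x)) (hselK _ hc)
    rw [hself _ hc, sub_self, abs_zero, mul_zero] at h1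
    have h2 : |g x - g (sel (f x))| = 0 := le_antisymm h1 (abs_nonneg _)
    rw [abs_eq_zero, sub_eq_zero] at h2
    simpa [hG₀] using h2
  rw [h0]
  exact hEq hc

/-- Head coherence passes to SUBSETS (the representation is asked on `closure K ⊆ closure C`). [folklore] -/
theorem HeadCoherent.mono {f g : E3 → ℝ} {L : ℝ} {K C : Set E3} (h : HeadCoherent f g L C) (hKC : K ⊆ C) :
    HeadCoherent f g L K := by
  obtain ⟨G, hG, hGe⟩ := h
  exact ⟨G, hG, fun x hx => hGe x (closure_mono hKC hx)⟩

/-! ### 2. ★ Every preconnected regular class of an analytic slice is head-coherent -/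

/-- ★ **Head coherence of a preconnected regular class (cell version of K1⁺, by name).**  On `S = S_r(x₀)` (`r > 0`) let `f, μ` be real-analytic
and `g ∈ C¹` off `x₀`, `∇g − μ∇f ∥ (x − x₀)` on `S`, `|μ| ≤ L` on `S`.  Then every PRECONNECTED `C ⊆ S` consisting of regular points of `f|_S`
(`∇f × (x − x₀) ≠ 0` on `C`) satisfies `HeadCoherent f g L C`: `g = G ∘ f` on `closure C` with `G` `L`-Lipschitz.
[`NetFlux.slice_le_of_analytic_regular_on_closure` + `headCoherent_of_slice_le`.] [folklore] -/
theorem headCoherent_of_analytic_regular_on {f g μ : E3 → ℝ} {x₀ : E3} {r L : ℝ} (hr : 0 < r)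
    (hf : AnalyticOnNhd ℝ f ({x₀}ᶜ : Set E3)) (hμ : AnalyticOnNhd ℝ μ ({x₀}ᶜ : Set E3))
    (hg : ContDiffOn ℝ 1 g ({x₀}ᶜ : Set E3))
    (hpar : ∀ x ∈ Metric.sphere x₀ r, cross (gradient g x - μ x • gradient f x) (x - x₀) = 0)
    (hL : ∀ x ∈ Metric.sphere x₀ r, |μ x| ≤ L)
    {C : Set E3} (hCS : C ⊆ Metric.sphere x₀ r) (hCreg : ∀ z ∈ C, cross (gradient f z) (z - x₀) ≠ 0)
    (hconn : IsPreconnected C) : HeadCoherent f g L C :=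
  headCoherent_of_slice_le fun _ hx _ hy =>
    NetFlux.slice_le_of_analytic_regular_on_closure hr hf hμ hg hpar hL hCS hCreg hconn hx hy

/-- ★ **A sphere with finitely many critical points is head-coherent as a whole** (the one-cell case: K1⁺
`NetFlux.levelLipschitz_of_analytic_finiteCrit`, p679110, packaged as `HeadCoherent f g L (S_r(x₀))`). [folklore] -/
theorem headCoherent_sphere_of_analytic_finiteCrit {f g μ : E3 → ℝ} {x₀ : E3} {r L : ℝ} (hr : 0 < r)
    (hf : AnalyticOnNhd ℝ f ({x₀}ᶜ : Set E3)) (hg : ContDiffOn ℝ 1 g ({x₀}ᶜ : Set E3))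
    (hμ : AnalyticOnNhd ℝ μ ({x₀}ᶜ : Set E3))
    (hpar : ∀ x ∈ Metric.sphere x₀ r, cross (gradient g x - μ x • gradient f x) (x - x₀) = 0)
    (hL : ∀ x ∈ Metric.sphere x₀ r, |μ x| ≤ L) (hfin : (sphCrit f x₀ r).Finite) :
    HeadCoherent f g L (Metric.sphere x₀ r) := by
  refine headCoherent_of_slice_le fun x hx y hy => ?_
  rw [Metric.isClosed_sphere.closure_eq] at hx hy
  exact NetFlux.levelLipschitz_of_analytic_finiteCrit f g μ x₀ r L hr hf hg hμ hpar hL hfin x hx y hy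

/-! ### 3. ★ The same in the binders of Λ-1 `HeadClusterRuleTame` / `AdmissibleRule` (one instant) -/

/-- On the sphere `S_r(x₀)` (`r > 0`), `‖v‖ ≤ V` gives `|⟪v x, x − x₀⟫| ≤ r V` (Cauchy–Schwarz). [folklore] -/
theorem abs_inner_sub_centre_le {v : E3 → E3} {x₀ : E3} {r V : ℝ} (hV : ∀ x ∈ Metric.sphere x₀ r, ‖v x‖ ≤ V)
    {x : E3} (hx : x ∈ Metric.sphere x₀ r) : |⟪v x, x - x₀⟫| ≤ r * V := by
  have hnorm : ‖x - x₀‖ = r := mem_sphere_iff_norm.1 hx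
  have hr : 0 ≤ r := hnorm ▸ norm_nonneg _
  calc |⟪v x, x - x₀⟫| ≤ ‖v x‖ * ‖x - x₀‖ := abs_real_inner_le_norm _ _
    _ = ‖v x‖ * r := by rw [hnorm]
    _ ≤ V * r := mul_le_mul_of_nonneg_right (hV x hx) hr
    _ = r * V := mul_comm _ _

/-- ★ **Head coherence in Λ-1's binders, one instant.**  Let `v` be analytic on `ℝ³` with `‖v‖ ≤ V` on `S_r(x₀)` (`r > 0`), `T` analytic and
`P ∈ C¹` off `x₀`, with the tangential head relation `(∇P − ⟪v, · − x₀⟫ ∇T) × (x − x₀) = 0` on the sphere (the binder of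
`HeadClusterRuleTame` / `ClusterFluxOneSidedLawTame` at a fixed time).  Then every preconnected set `C ⊆ S_r(x₀)` of regular points of
`T|_{S_r}` is head-coherent with the constant of `AdmissibleRule`: `HeadCoherent T P (r * V) C`. [folklore] -/
theorem headCoherent_of_linked_analytic_on {v : E3 → E3} {T P : E3 → ℝ} {x₀ : E3} {r V : ℝ} (hr : 0 < r)
    (hv : AnalyticOnNhd ℝ v (univ : Set E3)) (hT : AnalyticOnNhd ℝ T ({x₀}ᶜ : Set E3))
    (hP : ContDiffOn ℝ 1 P ({x₀}ᶜ : Set E3))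
    (hV : ∀ x ∈ Metric.sphere x₀ r, ‖v x‖ ≤ V)
    (hhead : ∀ x ∈ Metric.sphere x₀ r, cross (gradient P x - ⟪v x, x - x₀⟫ • gradient T x) (x - x₀) = 0)
    {C : Set E3} (hCS : C ⊆ Metric.sphere x₀ r) (hCreg : ∀ z ∈ C, cross (gradient T z) (z - x₀) ≠ 0)
    (hconn : IsPreconnected C) : HeadCoherent T P (r * V) C :=
  headCoherent_of_analytic_regular_on (μ := fun x => ⟪v x, x - x₀⟫) hr hT
    ((NetFlux.analyticOnNhd_loopMomentum' hv x₀).mono (subset_univ _)) hP hhead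
    (fun _ hx => abs_inner_sub_centre_le hV hx) hCS hCreg hconn

end Summit.NavierStokesRegularity.NavierStokesRegularity.Theorems.PoloidalLiouville.CellFlux

end
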